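import Mathlib.Tactic
import HarnessLib
import HarnessLib.Audit.Tags
import Summits.CriticalPhenomena.PercolationContinuityZ3.Theorems.PercNearOneGluingNoHeavyLowerTailSahiAntichainErase

/-!
# Antichains, meets plus joins: six members with at most eleven labels — above every effective point sits a sunflower

Support file (seat `prim-masterthm-p1`, gen 38; `--supports stmt-CriticalPhenomena-4575`).  No `sorry`, no new definitions, standard
axioms.  Memo `run/shared/lean/prim/prim-masterthm/FROM-prim-masterthm-p1-g38-BLOWUP-SIDE.md` §4.

SETTING: a six-member antichain `P` with `f P = #meets P + #joins P ≤ 11`.  Known: every effective point is a `3 + 3` point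
(`card_above_eq_three_of_six_le_eleven`, `…SixPrep`), and there `#meets (above) ≤ 2`, `#joins (below) ≤ 2` (`…Erase`).

NEW HERE ([this work], gen 38).
* `newJoins_nonempty_of_inter_eq`: three members above with two coincident meets `a₁ ∩ a₂ = a₁ ∩ a₃` ⟹ every member below has a new
  cross join (dual of `newMeets_nonempty_of_union_eq`, `…TwoThreeFa`, by complementation).
* **`exists_inter_eq_above_of_six_le_eleven`: in a six-member antichain with at most eleven labels, the three members containing any
  effective point form a SUNFLOWER** (all pairwise meets equal).  Proof: otherwise exactly two of the three meets above coincide,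
  `a₁ ∩ a₂ = a₁ ∩ a₃ ⊊ a₂ ∩ a₃`, so `f (above) ≥ 5`; below, either all joins coincide (a co-sunflower with union `U`) — then a point of
  `(a₂ ∩ a₃) \ a₁` lies in exactly two members above and in no or at least two members below, contradicting the `3 + 3` property at
  that point — or exactly two joins coincide, and then a new meet (`newMeets_nonempty_of_union_eq`) and a new join
  (`newJoins_nonempty_of_inter_eq`) give `f ≥ 5 + 5 + 2 = 12`.
This is the shape input of the structure theorem (companion file `…SixStructure`): together with the blow-up side lemma
(`four_le_newLabels_of_blowup`, `…BlowupSide`) it yields L4 and V5.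
HONEST FRAMING: unconditional lemmas. [this work]
-/

namespace Summit.CriticalPhenomena.PercolationContinuityZ3.Theorems.SahiColouredDaykin

open Finset

variable {α : Type*} [DecidableEq α]

/-! ### 1. Two coincident meets above give a new join (dual of the `(3,2)` lemma) -/

/-- **Type `(2,3)` above: every member below has a new cross join.**  Three members `a₁, a₂, a₃` above (all of them) with
`a₁ ∩ a₂ = a₁ ∩ a₃`, and a member `b` below: some cross join is new. [this work] -/
theorem newJoins_nonempty_of_inter_eq {P : Finset (Finset α)} {r : α} {b a₁ a₂ a₃ : Finset α}
    (hanti : IsAntichain (· ⊆ ·) (P : Set (Finset α)))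
    (hb : b ∈ below P r) (h1 : a₁ ∈ above P r) (h2 : a₂ ∈ above P r) (h3 : a₃ ∈ above P r)
    (h12 : a₁ ≠ a₂) (h13 : a₁ ≠ a₃) (h23 : a₂ ≠ a₃) (hall : ∀ a ∈ above P r, a = a₁ ∨ a = a₂ ∨ a = a₃)
    (hM : a₁ ∩ a₂ = a₁ ∩ a₃) : (newJoins P r).Nonempty := by
  set F := insert r (P.sup id) with hF
  have hP : ∀ a ∈ P, a ⊆ F := subset_insert_sup P r
  have hr : r ∈ F := mem_insert_self _ _
  have sub : ∀ {a : Finset α}, a ∈ above P r → a ⊆ F := fun ha => hP _ (above_subset P r ha)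
  have ne : ∀ {a a' : Finset α}, a ∈ above P r → a' ∈ above P r → a ≠ a' → F \ a ≠ F \ a' :=
    fun ha ha' hne h => hne (eq_of_sdiff_eq (sub ha) (sub ha') h)
  have memb : ∀ {a : Finset α}, a ∈ above P r → F \ a ∈ below (P.image (F \ ·)) r := by
    intro a ha; rw [below_image_compl (P := P) hr]; exact mem_image_of_mem _ ha
  have key := newMeets_nonempty_of_union_eq (P := P.image (F \ ·)) (r := r) (a := F \ b)
    (isAntichain_image_compl hanti hP)
    (by rw [above_image_compl (P := P) hr]; exact mem_image_of_mem _ hb)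
    (memb h1) (memb h2) (memb h3) (ne h1 h2 h12) (ne h1 h3 h13) (ne h2 h3 h23)
    (by
      intro x hx
      rw [below_image_compl (P := P) hr] at hx
      obtain ⟨a, ha, rfl⟩ := mem_image.1 hx
      rcases hall a ha with rfl | rfl | rfl
      · exact Or.inl rfl
      · exact Or.inr (Or.inl rfl)
      · exact Or.inr (Or.inr rfl))
    (by rw [← sdiff_inter_distrib_right, ← sdiff_inter_distrib_right, hM])
  rw [← card_pos, card_newMeets_image_compl hP hr, card_pos] at key
  exact key

/-! ### 2. The shape at an effective point -/

section Shape

variable {P : Finset (Finset α)} {s : α}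

/-- The members of `P` containing a point `t` that lie above `s` or below `s`: `above P t ⊆ above P s ∪ below P s`-bookkeeping. [this work] -/
theorem mem_above_or_below (P : Finset (Finset α)) (s : α) {a : Finset α} (ha : a ∈ P) : a ∈ above P s ∨ a ∈ below P s := by
  by_cases h : s ∈ a
  · exact Or.inl (mem_above_iff.2 ⟨ha, h⟩)
  · exact Or.inr (mem_below_iff.2 ⟨ha, h⟩)

/-- **No co-sunflower below two nested meets above.**  In a six-member antichain with at most eleven labels, if `a₁ ∩ a₂ = a₁ ∩ a₃ ≠ a₂ ∩ a₃`
for the three members above an effective point `s`, the three members below do not have all pairwise unions equal: a point of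
`(a₂ ∩ a₃) \ a₁` would be an effective point with two, four or five members above it. [this work] -/
theorem not_cosunflower_below_of_inter_eq (hanti : IsAntichain (· ⊆ ·) (P : Set (Finset α))) (h6 : #P = 6)
    (hf : #(meets P) + #(joins P) ≤ 11) {a₁ a₂ a₃ : Finset α}
    (h1 : a₁ ∈ above P s) (h2 : a₂ ∈ above P s) (h3 : a₃ ∈ above P s) (h23 : a₂ ≠ a₃)
    (hall : ∀ a ∈ above P s, a = a₁ ∨ a = a₂ ∨ a = a₃)
    (hM : a₁ ∩ a₂ = a₁ ∩ a₃) (hM' : a₁ ∩ a₂ ≠ a₂ ∩ a₃) (h3' : #(below P s) = 3) {U : Finset α}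
    (hU : ∀ b ∈ below P s, ∀ b' ∈ below P s, b ≠ b' → b ∪ b' = U) : False := by
  -- a point `t ∈ (a₂ ∩ a₃) \ a₁`
  have hsub : a₁ ∩ a₂ ⊆ a₂ ∩ a₃ := by
    intro x hx
    have hx' : x ∈ a₁ ∩ a₃ := hM ▸ hx
    exact mem_inter.2 ⟨(mem_inter.1 hx).2, (mem_inter.1 hx').2⟩
  obtain ⟨t, ht23, ht12⟩ := exists_of_ssubset (ssubset_of_subset_of_ne hsub hM')
  obtain ⟨ht2, ht3⟩ := mem_inter.1 ht23
  have ht1 : t ∉ a₁ := fun h => ht12 (mem_inter.2 ⟨h, ht2⟩)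
  -- `t` is effective, hence a `3 + 3` point
  have htE : t ∈ effPoints P := mem_effPoints_iff.2
    ⟨⟨a₂, mem_above_iff.2 ⟨above_subset P s h2, ht2⟩⟩, ⟨a₁, mem_below_iff.2 ⟨above_subset P s h1, ht1⟩⟩⟩
  have hcard := (card_above_eq_three_of_six_le_eleven hanti h6 hf htE).1
  have a2t : a₂ ∈ above P t := mem_above_iff.2 ⟨above_subset P s h2, ht2⟩
  have a3t : a₃ ∈ above P t := mem_above_iff.2 ⟨above_subset P s h3, ht3⟩
  obtain ⟨b₁, b₂, b₃, n12, n13, n23, hB⟩ := card_eq_three.1 h3'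
  have hb₁ : b₁ ∈ below P s := by rw [hB]; simp
  have hb₂ : b₂ ∈ below P s := by rw [hB]; simp
  have hb₃ : b₃ ∈ below P s := by rw [hB]; simp
  -- members above `s` differ from members below `s`
  have abne : ∀ {a b : Finset α}, a ∈ above P s → b ∈ below P s → a ≠ b := by
    intro a b ha hb h; rw [h] at ha; exact (mem_below_iff.1 hb).2 (mem_above_iff.1 ha).2
  by_cases htU : t ∈ U
  · -- `t` lies in at least two members below `s`: four members above `t`
    have two : ∃ b ∈ below P s, ∃ b' ∈ below P s, b ≠ b' ∧ t ∈ b ∧ t ∈ b' := by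
      by_cases htb₁ : t ∈ b₁
      · have : t ∈ b₂ ∪ b₃ := by rw [hU b₂ hb₂ b₃ hb₃ n23]; exact htU
        rcases mem_union.1 this with h | h
        · exact ⟨b₁, hb₁, b₂, hb₂, n12, htb₁, h⟩
        · exact ⟨b₁, hb₁, b₃, hb₃, n13, htb₁, h⟩
      · have h2' : t ∈ b₂ := by
          have : t ∈ b₁ ∪ b₂ := by rw [hU b₁ hb₁ b₂ hb₂ n12]; exact htU
          rcases mem_union.1 this with h | h
          · exact absurd h htb₁
          · exact h
        have h3'' : t ∈ b₃ := by
          have : t ∈ b₁ ∪ b₃ := by rw [hU b₁ hb₁ b₃ hb₃ n13]; exact htU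
          rcases mem_union.1 this with h | h
          · exact absurd h htb₁
          · exact h
        exact ⟨b₂, hb₂, b₃, hb₃, n23, h2', h3''⟩
    obtain ⟨b, hb, b', hb', hbb', htb, htb'⟩ := two
    have bt : b ∈ above P t := mem_above_iff.2 ⟨below_subset P s hb, htb⟩
    have b't : b' ∈ above P t := mem_above_iff.2 ⟨below_subset P s hb', htb'⟩
    have := four_le_card_of_mem a2t a3t bt b't h23 (abne h2 hb) (abne h2 hb') (abne h3 hb) (abne h3 hb') hbb'
    omega
  · -- `t ∉ U`: only `a₂, a₃` contain `t`
    have sub2 : above P t ⊆ {a₂, a₃} := by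
      intro a ha
      obtain ⟨haP, hta⟩ := mem_above_iff.1 ha
      rw [mem_insert, mem_singleton]
      rcases mem_above_or_below P s haP with h | h
      · rcases hall a h with rfl | rfl | rfl
        · exact absurd hta ht1
        · exact Or.inl rfl
        · exact Or.inr rfl
      · exfalso
        obtain ⟨b', hb', hne⟩ := exists_mem_ne (by omega : 1 < #(below P s)) a
        have : t ∈ a ∪ b' := mem_union_left _ hta
        rw [hU a h b' hb' hne.symm] at this
        exact htU this
    have := (card_le_card sub2).trans (card_le_two (a := a₂) (b := a₃))
    omega

/-- **The sunflower shape.**  In a six-member antichain with at most eleven labels, the three members containing an effective point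
have all pairwise meets equal. [this work] -/
theorem exists_inter_eq_above_of_six_le_eleven (hanti : IsAntichain (· ⊆ ·) (P : Set (Finset α))) (h6 : #P = 6)
    (hf : #(meets P) + #(joins P) ≤ 11) (hs : s ∈ effPoints P) :
    ∃ M, ∀ a ∈ above P s, ∀ a' ∈ above P s, a ≠ a' → a ∩ a' = M := by
  obtain ⟨hA3, hB3⟩ := card_above_eq_three_of_six_le_eleven hanti h6 hf hs
  obtain ⟨hm2, hj2⟩ := card_meets_above_le_two_of_six_le_eleven hanti h6 hf hs
  by_cases hm1 : #(meets (above P s)) ≤ 1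
  · exact exists_inter_eq_of_card_meets_le_one hm1 (by omega)
  exfalso
  have hantiA := isAntichain_above hanti s
  have hantiB := isAntichain_below hanti s
  obtain ⟨a, b, c, hab, hac, hbc, hA⟩ := card_eq_three.1 hA3
  have ha : a ∈ above P s := by rw [hA]; simp
  have hb : b ∈ above P s := by rw [hA]; simp
  have hc : c ∈ above P s := by rw [hA]; simp
  have hall : ∀ x ∈ above P s, x = a ∨ x = b ∨ x = c := by
    intro x hx; rw [hA, mem_insert, mem_insert, mem_singleton] at hx; exact hx
  -- not a sunflower: not all three meets coincide
  have nsun : ¬ (a ∩ b = a ∩ c ∧ a ∩ b = b ∩ c) := by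
    rintro ⟨e1, e2⟩
    apply hm1
    apply card_meets_le_one_of_sunflower (K := a ∩ b)
    intro x hx y hy hxy
    rcases hall x hx with rfl | rfl | rfl <;> rcases hall y hy with rfl | rfl | rfl
    · exact absurd rfl hxy
    · rfl
    · exact e1.symm
    · exact inter_comm _ _
    · exact absurd rfl hxy
    · exact e2.symm
    · rw [inter_comm]; exact e1.symm
    · rw [inter_comm]; exact e2.symm
    · exact absurd rfl hxy
  -- two meets coincide (else three distinct meets)
  have mab := inter_mem_meets ha hb hab
  have mac := inter_mem_meets ha hc hac
  have mbc := inter_mem_meets hb hc hbc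
  -- reduce to a labelled configuration `a₁ ∩ a₂ = a₁ ∩ a₃ ≠ a₂ ∩ a₃`
  have main : ∀ {a₁ a₂ a₃ : Finset α}, a₁ ∈ above P s → a₂ ∈ above P s → a₃ ∈ above P s → a₁ ≠ a₂ → a₁ ≠ a₃ → a₂ ≠ a₃ →
      (∀ x ∈ above P s, x = a₁ ∨ x = a₂ ∨ x = a₃) → a₁ ∩ a₂ = a₁ ∩ a₃ → a₁ ∩ a₂ ≠ a₂ ∩ a₃ → False := by
    intro a₁ a₂ a₃ h1 h2 h3 h12 h13 h23 hall' hM hM'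
    -- `f (above) ≥ 5`
    have n12 : ¬ a₁ ⊆ a₂ := hantiA (mem_coe.2 h1) (mem_coe.2 h2) h12
    have fA : 5 ≤ #(meets (above P s)) + #(joins (above P s)) := by
      rcases three_members_trichotomy hantiA hA3 with ⟨K, hK⟩ | ⟨V, hV⟩ | h5
      · exact absurd ((hK a₁ h1 a₂ h2 h12).trans (hK a₂ h2 a₃ h3 h23).symm) hM'
      · have n21 : ¬ a₂ ⊆ a₁ := hantiA (mem_coe.2 h2) (mem_coe.2 h1) h12.symm
        exact absurd hM (meets_distinct_of_union_eq n21 h23 ((hV a₁ h1 a₂ h2 h12).trans (hV a₁ h1 a₃ h3 h13).symm)).1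
      · exact h5
    -- below: a co-sunflower is impossible; so exactly two joins coincide
    by_cases hj1 : #(joins (below P s)) ≤ 1
    · obtain ⟨U, hU⟩ := exists_union_eq_of_card_joins_le_one hj1 (by omega)
      exact not_cosunflower_below_of_inter_eq hanti h6 hf h1 h2 h3 h23 hall' hM hM' hB3 hU
    obtain ⟨b₁, b₂, b₃, n12', n13', n23', hB⟩ := card_eq_three.1 hB3
    have hb₁ : b₁ ∈ below P s := by rw [hB]; simp
    have hb₂ : b₂ ∈ below P s := by rw [hB]; simp
    have hb₃ : b₃ ∈ below P s := by rw [hB]; simp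
    have hallB : ∀ x ∈ below P s, x = b₁ ∨ x = b₂ ∨ x = b₃ := by
      intro x hx; rw [hB, mem_insert, mem_insert, mem_singleton] at hx; exact hx
    have jb12 : b₁ ∪ b₂ ∈ joins (below P s) := mem_joins_iff.2 ⟨b₁, hb₁, b₂, hb₂, n12', rfl⟩
    have jb13 : b₁ ∪ b₃ ∈ joins (below P s) := mem_joins_iff.2 ⟨b₁, hb₁, b₃, hb₃, n13', rfl⟩
    have jb23 : b₂ ∪ b₃ ∈ joins (below P s) := mem_joins_iff.2 ⟨b₂, hb₂, b₃, hb₃, n23', rfl⟩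
    -- a labelled pair of coincident joins below closes the argument
    have fin : ∀ {c₁ c₂ c₃ : Finset α}, c₁ ∈ below P s → c₂ ∈ below P s → c₃ ∈ below P s → c₁ ≠ c₂ → c₁ ≠ c₃ → c₂ ≠ c₃ →
        (∀ x ∈ below P s, x = c₁ ∨ x = c₂ ∨ x = c₃) → c₁ ∪ c₂ = c₁ ∪ c₃ → c₁ ∪ c₂ ≠ c₂ ∪ c₃ → False := by
      intro c₁ c₂ c₃ k1 k2 k3 k12 k13 k23 hallC hW hW'
      have fB : 5 ≤ #(meets (below P s)) + #(joins (below P s)) := by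
        rcases three_members_trichotomy hantiB hB3 with ⟨K, hK⟩ | ⟨V, hV⟩ | h5
        · have nc12 : ¬ c₁ ⊆ c₂ := hantiB (mem_coe.2 k1) (mem_coe.2 k2) k12
          exact absurd hW (joins_distinct_of_inter_eq nc12 k23 ((hK c₁ k1 c₂ k2 k12).trans (hK c₁ k1 c₃ k3 k13).symm)).1
        · exact absurd ((hV c₁ k1 c₂ k2 k12).trans (hV c₂ k2 c₃ k3 k23).symm) hW'
        · exact h5
      have hx : 1 ≤ #(newMeets P s) :=
        card_pos.2 (newMeets_nonempty_of_union_eq hanti h1 k1 k2 k3 k12 k13 k23 hallC hW)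
      have hy : 1 ≤ #(newJoins P s) :=
        card_pos.2 (newJoins_nonempty_of_inter_eq hanti k1 h1 h2 h3 h12 h13 h23 hall' hM)
      have hsplit := card_meets_add_card_joins_split P s
      unfold newLabels at hsplit
      omega
    by_cases e1 : b₁ ∪ b₂ = b₁ ∪ b₃
    · by_cases e2 : b₁ ∪ b₂ = b₂ ∪ b₃
      · -- all joins equal: `#joins ≤ 1`
        apply hj1
        apply card_joins_le_one_of_cosunflower (U := b₁ ∪ b₂)
        intro x hx y hy hxy
        rcases hallB x hx with rfl | rfl | rfl <;> rcases hallB y hy with rfl | rfl | rfl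
        · exact absurd rfl hxy
        · rfl
        · exact e1.symm
        · exact union_comm _ _
        · exact absurd rfl hxy
        · exact e2.symm
        · rw [union_comm]; exact e1.symm
        · rw [union_comm]; exact e2.symm
        · exact absurd rfl hxy
      · exact fin hb₁ hb₂ hb₃ n12' n13' n23' hallB e1 e2
    · by_cases e2 : b₁ ∪ b₂ = b₂ ∪ b₃
      · -- `b₂ ∪ b₁ = b₂ ∪ b₃ ≠ b₁ ∪ b₃`
        refine fin hb₂ hb₁ hb₃ n12'.symm n23' n13' ?_ (by rw [union_comm]; exact e2) (by rw [union_comm]; exact e1)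
        intro x hx; rcases hallB x hx with h | h | h
        · exact Or.inr (Or.inl h)
        · exact Or.inl h
        · exact Or.inr (Or.inr h)
      · by_cases e3 : b₁ ∪ b₃ = b₂ ∪ b₃
        · -- `b₃ ∪ b₁ = b₃ ∪ b₂ ≠ b₁ ∪ b₂`
          refine fin hb₃ hb₁ hb₂ n13'.symm n23'.symm n12' ?_
            (by rw [union_comm, e3, union_comm]) (by rw [union_comm]; exact fun h => e1 h.symm)
          intro x hx; rcases hallB x hx with h | h | h
          · exact Or.inr (Or.inl h)
          · exact Or.inr (Or.inr h)
          · exact Or.inl h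
        · -- three distinct joins below: `#joins ≥ 3`
          have := three_le_card_of_mem jb12 jb13 jb23 e1 e2 e3
          omega
  by_cases e1 : a ∩ b = a ∩ c
  · exact main ha hb hc hab hac hbc hall e1 (fun h => nsun ⟨e1, h⟩)
  · by_cases e2 : a ∩ b = b ∩ c
    · refine main hb ha hc hab.symm hbc hac ?_ (by rw [inter_comm]; exact e2) (by rw [inter_comm]; exact e1)
      intro x hx; rcases hall x hx with h | h | h
      · exact Or.inr (Or.inl h)
      · exact Or.inl h
      · exact Or.inr (Or.inr h)
    · by_cases e3 : a ∩ c = b ∩ c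
      · refine main hc ha hb hac.symm hbc.symm hab ?_ (by rw [inter_comm, e3, inter_comm])
          (by rw [inter_comm]; exact fun h => e1 h.symm)
        intro x hx; rcases hall x hx with h | h | h
        · exact Or.inr (Or.inl h)
        · exact Or.inr (Or.inr h)
        · exact Or.inl h
      · have := three_le_card_of_mem mab mac mbc e1 e2 e3
        omega

end Shape

end Summit.CriticalPhenomena.PercolationContinuityZ3.Theorems.SahiColouredDaykin
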